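import Summits.PneNP.PneNP.Theorems.ChebyshevTracialDesignGammaDirectionAverage
import HarnessLib

/-!
# Cell pnp-psdrank, route `ChebyshevTracialDesign`: brick 144 with MATCHING-DEPENDENT type-constant directions — brick 145c
# (crux `TracialDecayExp20`, stmt-PneNP-19878)

Brick 145c (prover g29; MEMO-32 §3). Brick 144 (`…GammaDirectionAverage.gammaDirection_designValue_le`) averages brick 143's per-matching bound over
all matchings for ONE type-constant direction `(γ, λ, κ)`. Brick 143 is a per-matching statement, so the same average holds when the direction
`(γ_M, λ_M, κ_M) ∈ [−1,1]³` DEPENDS ON THE MATCHING — which is what the all-directions reduction (brick 145b: the type-average `ṽ_M` of an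
arbitrary direction field `c_M` is type-constant but `M`-dependent) consumes. The proof is brick 144's, token for token, with `γ ↦ γ_M` etc.:
* **`gammaDirection_designValue_le_dep`**: for every `a′ > 0` there is `n₀` such that for `n ≥ n₀`, every balanced exact design (`2 ≤ D`, `D⁴ ≤ n`,
  `2D+1 ≤ T ≤ 7⌊√n⌋`), every balanced block `|H| = n/2`, every `0 ≤ ψ ≤ G` and all `γ, λ, κ : PM_n → [−1,1]`:
  `Σ_M Σ_U W(U,M)·ψ(|U∩H|)·C_{γ_M,λ_M,κ_M}(U,M)² ≤ 2·10⁴·(1+B_v)·G·n⁶·(e^{−a′D} + 2^{−⌊n/40⌋})`.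
WHAT THIS FILE DOES NOT DO: directions that are not type-constant (brick 145d), anything on `TracialDecayExp20` itself, psd rank of P_PM(K_n), or P vs NP.
[cite: Rothvoss2017, §2 (PDF pp. 5–6)] [cite: RollinRoss2010, §4.1 Thm 4.2] [cite: Durrett2019, §2.7]
Stature: support/instrument (kernel lane, no defs, axioms standard). Supports stmt-PneNP-19878.
-/

set_option linter.dupNamespace false -- `Summit.PneNP.PneNP.…`: summit = sub-problem (D-0017)

noncomputable section

namespace Summit.PneNP.PneNP.Theorems.ChebyshevTracialDesignGammaDirectionAverageDep

open Finset Literature.Barriers.PneNP Literature.Combinatorics.Optimization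
open Literature.Combinatorics.Optimization.ShellStep
open Literature.Combinatorics.SimpleGraph.CycleSpace
open Summit.PneNP.PneNP.Theorems.ChebyshevTracialDesignGammaDirectionExp (gammaDirection_value_le_exp)
open Summit.PneNP.PneNP.Theorems.ChebyshevTracialDesignGammaDirectionAverage (gamma_value_le_trivial)
open Summit.PneNP.PneNP.Theorems.ChebyshevTracialDesignCrossingPlaneAverage (card_reps_vB_eq_card_crosses)
open Summit.PneNP.PneNP.Theorems.ChebyshevTracialDesignCrossingCountTailsExplicit
  (card_pmatch_crosses_le_le card_pmatch_le_crosses_le)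

variable {n : ℕ}

/-! ### §1 The average over all matchings, matching-dependent type-constant directions -/

/-- **(CG_1′) IN MATCHING-DEPENDENT TYPE-CONSTANT DIRECTIONS, AVERAGED OVER ALL MATCHINGS (brick 145c = brick 144 with `γ_M, λ_M, κ_M`).** For every `a′ > 0` there is `n₀` such
that for all `n ≥ n₀`: for every balanced exact design `(n,t,T,D,B_v,C,w)` with `2 ≤ D`, `D⁴ ≤ n`, `2D+1 ≤ T ≤ 7⌊√n⌋`, every
balanced block `|H| = n/2`, every `0 ≤ ψ ≤ G` on `[0,t]` and `|γ|,|λ|,|κ| ≤ 1`, the DESIGN VALUE of the tilted mask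
`F(U,M) = ψ(|U∩H|)·C_{γ,λ,κ}(U,M)²` obeys `Σ_M Σ_U W(U,M)·F(U,M) ≤ 2·10⁴·(1+B_v)·G·n⁶·(e^{−a′D} + 2^{−⌊n/40⌋})` (non-aligned matchings by
brick 143 with `β = 1/40`, aligned ones by the engine's `2^{−⌊n/40⌋}` crossing-count tails and the trivial bound).
[cite: Rothvoss2017, §2 (PDF pp. 5–6)] [cite: RollinRoss2010, §4.1 Thm 4.2] [cite: Durrett2019, §2.7] -/
theorem gammaDirection_designValue_le_dep {a' : ℝ} (ha' : 0 < a') :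
    ∃ n₀ : ℕ, ∀ n : ℕ, n₀ ≤ n → ∀ {t T D : ℕ} {Bv : ℝ} {C : Finset ℕ} {w : ℕ → ℝ},
    IsExactDesign n t T D Bv C w → 2 * D + 1 ≤ T → n ≤ 4 * t → 2 ≤ D → D ^ 4 ≤ n → T ≤ 7 * Nat.sqrt n →
    ∀ (H : Finset (Fin n)), 2 * H.card = n →
    ∀ (ψ : ℤ → ℝ) {G : ℝ}, 0 ≤ G → (∀ x ∈ Icc (0 : ℤ) ((t : ℕ) : ℤ), |ψ x| ≤ G) →
    (∀ x ∈ Icc (0 : ℤ) ((t : ℕ) : ℤ), 0 ≤ ψ x) → ∀ (gam lam kap : PMatch n → ℝ), (∀ M, |gam M| ≤ 1) → (∀ M, |lam M| ≤ 1) →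
    (∀ M, |kap M| ≤ 1) →
    ∑ M : PMatch n, ∑ U : OddSet n, levelWeight n t C w U M *
        (ψ ((U.1 ∩ H).card : ℤ) *
          (∑ p : Fin n, (gam M * (if (p ∈ H ∧ M.2.partner p ∈ H) then (1 : ℝ) else 0) +
              (lam M * ((if (p ∈ H ∧ M.2.partner p ∈ H) then (1 : ℝ) else 0) -
                (if (p ∉ H ∧ M.2.partner p ∉ H) then (1 : ℝ) else 0)) + (lam M + kap M))) *
            ((if p ∈ U.1 then (1 : ℝ) else 0) * (if M.2.partner p ∈ U.1 then (1 : ℝ) else 0))) ^ 2) ≤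
      2 * 10 ^ 4 * (1 + Bv) * G * (n : ℝ) ^ 6 * (Real.exp (-(a' * D)) + (1 / 2 : ℝ) ^ (n / 40)) := by
  obtain ⟨n₁, h143⟩ := gammaDirection_value_le_exp (β := 1 / 40) (a' := a') (by norm_num) ha'
  refine ⟨max n₁ 80, ?_⟩
  intro n hn t T D Bv C w hdes hDT hbal hD2 hD4 hT7 H hH ψ G hG0 hG hψ0 gam lam kap hgam hlam hkap
  have hn₁ : n₁ ≤ n := le_trans (le_max_left _ _) hn
  have hn80 : 80 ≤ n := le_trans (le_max_right _ _) hn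
  have hBv : 0 ≤ Bv := le_trans (sum_nonneg fun c _ => abs_nonneg _) hdes.2.2.2.2.2.2
  -- abbreviations: the per-matching value `V`, the bounds `B₁`, `B₂`, the threshold `a₀`
  set V : PMatch n → ℝ := fun M => (Fintype.card (PMatch n) : ℝ) * ∑ U : OddSet n, levelWeight n t C w U M *
        (ψ ((U.1 ∩ H).card : ℤ) *
          (∑ p : Fin n, (gam M * (if (p ∈ H ∧ M.2.partner p ∈ H) then (1 : ℝ) else 0) +
              (lam M * ((if (p ∈ H ∧ M.2.partner p ∈ H) then (1 : ℝ) else 0) -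
                (if (p ∉ H ∧ M.2.partner p ∉ H) then (1 : ℝ) else 0)) + (lam M + kap M))) *
            ((if p ∈ U.1 then (1 : ℝ) else 0) * (if M.2.partner p ∈ U.1 then (1 : ℝ) else 0))) ^ 2) with hVdef
  obtain ⟨B₁, hB₁⟩ : ∃ e : ℝ, e = 2 * 10 ^ 4 * (1 + Bv) * G * (n : ℝ) ^ 6 * Real.exp (-(a' * D)) := ⟨_, rfl⟩
  obtain ⟨B₂, hB₂⟩ : ∃ e : ℝ, e = 16 * (n : ℝ) ^ 2 * G * Bv := ⟨_, rfl⟩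
  have hB₁0 : 0 ≤ B₁ := by rw [hB₁]; positivity
  have hB₂0 : 0 ≤ B₂ := by rw [hB₂]; positivity
  obtain ⟨a₀, ha₀⟩ : ∃ a : ℕ, a = n / 40 := ⟨_, rfl⟩
  -- the good matchings
  set good : Finset (PMatch n) := univ.filter fun M => a₀ < (M.1.filter (Crosses H)).card ∧
    (M.1.filter (Crosses H)).card + a₀ < H.card with hgood
  have hgoodV : ∀ M ∈ good, V M ≤ B₁ := by
    intro M hM
    obtain ⟨h1, h2⟩ := (mem_filter.1 hM).2
    rw [← card_reps_vB_eq_card_crosses M H] at h1 h2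
    have ha : (n : ℝ) ≤ 40 * ((a₀ : ℝ) + 1) := by
      have : n < 40 * (a₀ + 1) := by omega
      exact_mod_cast this.le
    have hlo : (1 / 40 : ℝ) * n ≤ (reps M.2.partner (vBH M.2.partner univ H ∪ vBN M.2.partner univ H)).card := by
      have : ((a₀ + 1 : ℕ) : ℝ) ≤ (reps M.2.partner (vBH M.2.partner univ H ∪ vBN M.2.partner univ H)).card := by
        exact_mod_cast h1
      push_cast at this; linarith
    have hhi : ((reps M.2.partner (vBH M.2.partner univ H ∪ vBN M.2.partner univ H)).card : ℝ) ≤ (1 / 2 - 1 / 40) * n := by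
      have : (((reps M.2.partner (vBH M.2.partner univ H ∪ vBN M.2.partner univ H)).card + a₀ + 1 : ℕ) : ℝ) ≤
          H.card := by exact_mod_cast h2
      have hHr : (H.card : ℝ) = (n : ℝ) / 2 := by
        have : ((2 * H.card : ℕ) : ℝ) = n := by exact_mod_cast hH
        push_cast at this; linarith
      push_cast at this; linarith
    rw [hB₁]
    exact h143 n hn₁ hdes hDT hbal hD2 hD4 hT7 M H hH hlo hhi ψ hG0 hG hψ0 (gam M) (lam M) (kap M) (hgam M) (hlam M) (hkap M)
  -- every matching
  have hallV : ∀ M, V M ≤ B₂ := fun M => by rw [hB₂]; exact gamma_value_le_trivial hdes M H ψ hG0 hG (hgam M) (hlam M) (hkap M)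
  -- the bad matchings are few
  have hHc : 9 * a₀ + 1 ≤ H.card ∧ 9 * a₀ + 1 ≤ n - H.card ∧ n - H.card = H.card ∧ 9 * (a₀ + 1) ≤ H.card := by omega
  have hbad : (((univ.filter fun M : PMatch n => ¬ (a₀ < (M.1.filter (Crosses H)).card ∧
      (M.1.filter (Crosses H)).card + a₀ < H.card)).card : ℕ) : ℝ) ≤
      2 * (1 / 2 : ℝ) ^ a₀ * (Fintype.card (PMatch n) : ℝ) := by
    have hsub : (univ.filter fun M : PMatch n => ¬ (a₀ < (M.1.filter (Crosses H)).card ∧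
        (M.1.filter (Crosses H)).card + a₀ < H.card)) ⊆
        (univ.filter fun M : PMatch n => (M.1.filter (Crosses H)).card ≤ a₀) ∪
        (univ.filter fun M : PMatch n => H.card ≤ (M.1.filter (Crosses H)).card + a₀) := by
      intro M hM
      rw [mem_filter] at hM
      rw [mem_union, mem_filter, mem_filter]
      by_cases h : (M.1.filter (Crosses H)).card ≤ a₀
      · exact Or.inl ⟨mem_univ _, h⟩
      · right; refine ⟨mem_univ _, ?_⟩
        by_contra h'
        exact hM.2 ⟨by omega, by omega⟩
    have h1 := card_pmatch_crosses_le_le H hHc.1 hHc.2.1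
    have h2 := card_pmatch_le_crosses_le H hHc.2.2.1 hHc.2.2.2
    have h3 := (card_le_card hsub).trans (card_union_le _ _)
    have h3' : (((univ.filter fun M : PMatch n => ¬ (a₀ < (M.1.filter (Crosses H)).card ∧
        (M.1.filter (Crosses H)).card + a₀ < H.card)).card : ℕ) : ℝ) ≤
        (((univ.filter fun M : PMatch n => (M.1.filter (Crosses H)).card ≤ a₀).card : ℕ) : ℝ) +
        (((univ.filter fun M : PMatch n => H.card ≤ (M.1.filter (Crosses H)).card + a₀).card : ℕ) : ℝ) := by
      exact_mod_cast h3
    linarith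
  -- the average
  have hPMpos : ∀ M : PMatch n, (0 : ℝ) < Fintype.card (PMatch n) := fun M => by
    have : 0 < Fintype.card (PMatch n) := Fintype.card_pos_iff.2 ⟨M⟩
    exact_mod_cast this
  have hsumV : ∑ M : PMatch n, ∑ U : OddSet n, levelWeight n t C w U M *
        (ψ ((U.1 ∩ H).card : ℤ) *
          (∑ p : Fin n, (gam M * (if (p ∈ H ∧ M.2.partner p ∈ H) then (1 : ℝ) else 0) +
              (lam M * ((if (p ∈ H ∧ M.2.partner p ∈ H) then (1 : ℝ) else 0) -
                (if (p ∉ H ∧ M.2.partner p ∉ H) then (1 : ℝ) else 0)) + (lam M + kap M))) *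
            ((if p ∈ U.1 then (1 : ℝ) else 0) * (if M.2.partner p ∈ U.1 then (1 : ℝ) else 0))) ^ 2) =
      ∑ M : PMatch n, (Fintype.card (PMatch n) : ℝ)⁻¹ * V M := by
    refine sum_congr rfl fun M _ => ?_
    rw [hVdef]
    simp only []
    rw [← mul_assoc, inv_mul_cancel₀ (hPMpos M).ne', one_mul]
  rw [hsumV, ← mul_sum, ← sum_filter_add_sum_filter_not univ (fun M : PMatch n =>
    a₀ < (M.1.filter (Crosses H)).card ∧ (M.1.filter (Crosses H)).card + a₀ < H.card)]
  have hgood_sum : ∑ M ∈ good, V M ≤ (good.card : ℝ) * B₁ := by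
    rw [← nsmul_eq_mul, ← sum_const]; exact sum_le_sum hgoodV
  have hbad_sum : ∑ M ∈ univ.filter (fun M : PMatch n => ¬ (a₀ < (M.1.filter (Crosses H)).card ∧
      (M.1.filter (Crosses H)).card + a₀ < H.card)), V M ≤
      ((univ.filter fun M : PMatch n => ¬ (a₀ < (M.1.filter (Crosses H)).card ∧
        (M.1.filter (Crosses H)).card + a₀ < H.card)).card : ℝ) * B₂ := by
    rw [← nsmul_eq_mul, ← sum_const]; exact sum_le_sum fun M _ => hallV M
  have hgood_card : (good.card : ℝ) ≤ Fintype.card (PMatch n) := by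
    exact_mod_cast card_le_univ good
  -- if there is no matching the sum is empty
  by_cases hPM : Fintype.card (PMatch n) = 0
  · have : IsEmpty (PMatch n) := Fintype.card_eq_zero_iff.1 hPM
    simp only [univ_eq_empty, filter_empty, sum_empty, add_zero, mul_zero]
    positivity
  have hPMr : (0 : ℝ) < Fintype.card (PMatch n) := by
    have : 0 < Fintype.card (PMatch n) := Nat.pos_of_ne_zero hPM
    exact_mod_cast this
  rw [← hgood]
  calc (Fintype.card (PMatch n) : ℝ)⁻¹ * (∑ M ∈ good, V M +
        ∑ M ∈ univ.filter (fun M : PMatch n => ¬ (a₀ < (M.1.filter (Crosses H)).card ∧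
          (M.1.filter (Crosses H)).card + a₀ < H.card)), V M)
      ≤ (Fintype.card (PMatch n) : ℝ)⁻¹ * ((Fintype.card (PMatch n) : ℝ) * B₁ +
          (2 * (1 / 2 : ℝ) ^ a₀ * (Fintype.card (PMatch n) : ℝ)) * B₂) := by
        refine mul_le_mul_of_nonneg_left ?_ (by positivity)
        nlinarith [hgood_sum, hbad_sum, hgood_card, hbad, hB₁0, hB₂0]
    _ = B₁ + 2 * (1 / 2 : ℝ) ^ a₀ * B₂ := by field_simp
    _ ≤ 2 * 10 ^ 4 * (1 + Bv) * G * (n : ℝ) ^ 6 * (Real.exp (-(a' * D)) + (1 / 2 : ℝ) ^ (n / 40)) := by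
        rw [hB₁, hB₂, ha₀, mul_add]
        have hn1 : (1 : ℝ) ≤ n := by exact_mod_cast (show 1 ≤ n by omega)
        have hn26 : (n : ℝ) ^ 2 ≤ (n : ℝ) ^ 6 := pow_le_pow_right₀ hn1 (by norm_num)
        have hp : (0 : ℝ) ≤ (1 / 2 : ℝ) ^ (n / 40) := by positivity
        have : 2 * (1 / 2 : ℝ) ^ (n / 40) * (16 * (n : ℝ) ^ 2 * G * Bv) ≤
            2 * 10 ^ 4 * (1 + Bv) * G * (n : ℝ) ^ 6 * (1 / 2 : ℝ) ^ (n / 40) := by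
          have h32 : 32 * ((n : ℝ) ^ 2 * G * Bv) ≤ 2 * 10 ^ 4 * ((1 + Bv) * G * (n : ℝ) ^ 6) := by
            nlinarith [mul_nonneg hG0 hBv, mul_le_mul_of_nonneg_left hn26 (mul_nonneg hG0 hBv),
              mul_nonneg hG0 (pow_nonneg (by linarith : (0:ℝ) ≤ n) 6)]
          nlinarith [mul_le_mul_of_nonneg_left h32 hp]
        linarith


end Summit.PneNP.PneNP.Theorems.ChebyshevTracialDesignGammaDirectionAverageDep

end
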